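import Literature.MathematicalPhysics.QuantumFieldTheory.YangMillsOS
import Literature.MathematicalPhysics.QuantumFieldTheory.LatticeGaugeDobrushinPoincare
import Literature.MathematicalPhysics.QuantumLattice.TorusWilsonGibbs
import Literature.Probability.LatticeModels.GibbsSpecificationTiltedRatio

/-!
# Stub `stub_lipschitzKernelVersion` of line `Sketch` (one-form Witten / IMS) for crux stmt-QuantumFields-8761
(`Summit.QuantumFields.YangMills.Theses.EquipartitionCriticality.LatticeGapLargeBeta`)

One heat-bath step regularises: the DLR kernel of the plaquette potential is a collar-local,
bounded, LIPSCHITZ version of the conditional expectation given the links off `Λ`.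
Matrix bookkeeping (`frobNorm_quad_sub_le`, …, `plaquetteHolonomy_update_of_not_mem`): one link
`U_e ↦ h` moves `Re tr ρ(U_p)` by `≤ 4 √N ‖ρ h − ρ U_e‖_F`, and not at all if `e ∉ p`;
`exists_plaquettePotential_lipschitz`: the plaquette potential of `TorusWilsonGibbs` plus a one-link
Lipschitz bound of its Hamiltonians uniform in the torus; `stub_lipschitzKernelVersion`: the stub.
-/

noncomputable section

open scoped BigOperators Topology Matrix
open MeasureTheory ProbabilityTheory Filter
open Literature.MathematicalPhysics.QuantumFieldTheory Literature.MathematicalPhysics.QuantumLattice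
open Literature.Probability.LatticeModels (Potential hamiltonianIn gibbsSpecOfPotential glueWith
  glueWith_apply_mem glueWith_apply_not_mem isSpecification_gibbsSpecOfPotential
  integral_glued_tilted_le_exp_mul abs_hamiltonianIn_le measurable_hamiltonianIn)

namespace Summit.QuantumFields.YangMills.Theorems.LatticeGapLargeBeta.WittenIMS

/-! ### Matrix bookkeeping: one link moves a plaquette trace by `≤ 4 √N ‖Δρ‖_F` -/

section MatrixToolkit

variable {N : ℕ}

/-- Telescoping for four unitary factors:
`‖A₁A₂A₃A₄ − B₁B₂B₃B₄‖_F ≤ ∑ₖ ‖Aₖ − Bₖ‖_F` (unitary invariance of the Frobenius norm). -/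
theorem frobNorm_quad_sub_le {A₁ A₂ A₃ A₄ B₁ B₂ B₃ B₄ : Matrix (Fin N) (Fin N) ℂ}
    (hA₂ : A₂ ∈ Matrix.unitaryGroup (Fin N) ℂ) (hA₃ : A₃ ∈ Matrix.unitaryGroup (Fin N) ℂ)
    (hA₄ : A₄ ∈ Matrix.unitaryGroup (Fin N) ℂ) (hB₁ : B₁ ∈ Matrix.unitaryGroup (Fin N) ℂ)
    (hB₂ : B₂ ∈ Matrix.unitaryGroup (Fin N) ℂ) (hB₃ : B₃ ∈ Matrix.unitaryGroup (Fin N) ℂ) :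
    frobNorm (A₁ * A₂ * A₃ * A₄ - B₁ * B₂ * B₃ * B₄) ≤
      frobNorm (A₁ - B₁) + frobNorm (A₂ - B₂) + frobNorm (A₃ - B₃) + frobNorm (A₄ - B₄) := by
  have hsplit : A₁ * A₂ * A₃ * A₄ - B₁ * B₂ * B₃ * B₄ =
      (A₁ * A₂ * A₃ - B₁ * B₂ * B₃) * A₄ + B₁ * B₂ * B₃ * (A₄ - B₄) := by
    simp only [sub_mul, mul_sub]
    abel
  rw [hsplit]
  calc frobNorm ((A₁ * A₂ * A₃ - B₁ * B₂ * B₃) * A₄ + B₁ * B₂ * B₃ * (A₄ - B₄))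
      ≤ frobNorm ((A₁ * A₂ * A₃ - B₁ * B₂ * B₃) * A₄) + frobNorm (B₁ * B₂ * B₃ * (A₄ - B₄)) :=
        frobNorm_add_le _ _
    _ = frobNorm (A₁ * A₂ * A₃ - B₁ * B₂ * B₃) + frobNorm (A₄ - B₄) := by
        congr 1
        · exact frobNorm_mul_unitary _ hA₄
        · exact frobNorm_unitary_mul (Submonoid.mul_mem _ (Submonoid.mul_mem _ hB₁ hB₂) hB₃) _
    _ ≤ _ := add_le_add_left (frobNorm_triple_sub_le hA₂ hA₃ hB₁ hB₂) _

/-- `|Re tr X − Re tr Y| ≤ √N ‖X − Y‖_F` (Cauchy–Schwarz for the Hilbert–Schmidt pairing with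
the identity, `‖1‖_F = √N`). -/
theorem abs_re_trace_sub_le (X Y : Matrix (Fin N) (Fin N) ℂ) :
    |X.trace.re - Y.trace.re| ≤ Real.sqrt N * frobNorm (X - Y) := by
  have h1 : frobNorm (1 : Matrix (Fin N) (Fin N) ℂ) = Real.sqrt N := by
    rw [← Real.sqrt_sq (frobNorm_nonneg _), frobNorm_sq_of_mem_unitaryGroup (Submonoid.one_mem _),
      Fintype.card_fin]
  have := abs_re_trace_mul_le (1 : Matrix (Fin N) (Fin N) ℂ) (X - Y)
  rwa [one_mul, h1, Matrix.trace_sub, Complex.sub_re] at this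

variable {d L : ℕ} {G : Type*} [Group G] (ρ : G →* Matrix (Fin N) (Fin N) ℂ)

/-- **One link moves a plaquette trace by at most `4 √N ‖ρ h − ρ U_e‖_F`**: for a unitary `ρ`,
`ρ(U_p) = ρ(U₁) ρ(U₂) ρ(U₃)* ρ(U₄)*` is a product of four unitary factors each of which moves (in
`‖·‖_F`) by at most `‖ρ h − ρ U_e‖_F` under `U_e ↦ h` (several positions may be the edge `e` on a
tiny torus), and `|Re tr X − Re tr Y| ≤ √N ‖X − Y‖_F`. -/
theorem abs_re_trace_holonomy_update_sub_le (hρu : ∀ g, ρ g ∈ Matrix.unitaryGroup (Fin N) ℂ)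
    (U : GaugeConfig d L G) (e : Edge d L) (h : G) (x : Site d L) (i j : Fin d) :
    |(ρ (plaquetteHolonomy (Function.update U e h) x i j)).trace.re -
        (ρ (plaquetteHolonomy U x i j)).trace.re| ≤
      Real.sqrt N * (4 * frobNorm (ρ h - ρ (U e))) := by
  have hct : ∀ g, (ρ g)ᴴ ∈ Matrix.unitaryGroup (Fin N) ℂ := fun g => by
    rw [← Matrix.star_eq_conjTranspose]
    exact Unitary.star_mem (hρu g)
  have key : ∀ e',
      frobNorm (ρ (Function.update U e h e') - ρ (U e')) ≤ frobNorm (ρ h - ρ (U e)) := fun e' => by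
    by_cases he : e' = e
    · rw [he, Function.update_self]
    · rw [Function.update_of_ne he, sub_self, frobNorm_zero]
      exact frobNorm_nonneg _
  have key' : ∀ e', frobNorm ((ρ (Function.update U e h e'))ᴴ - (ρ (U e'))ᴴ) ≤
      frobNorm (ρ h - ρ (U e)) := fun e' => by
    rw [← Matrix.conjTranspose_sub, frobNorm_conjTranspose]
    exact key e'
  simp only [plaquetteHolonomy, map_mul, map_inv_eq_conjTranspose ρ hρu]
  refine (abs_re_trace_sub_le _ _).trans (mul_le_mul_of_nonneg_left ?_ (Real.sqrt_nonneg _))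
  refine (frobNorm_quad_sub_le (hρu _) (hct _) (hct _) (hρu _) (hρu _) (hct _)).trans ?_
  linarith [key (x, i), key (x.shift i, j), key' (x.shift j, i), key' (x, j)]

/-- A link outside the plaquette does not move its holonomy. -/
theorem plaquetteHolonomy_update_of_not_mem (U : GaugeConfig d L G) {e : Edge d L}
    (h : G) {x : Site d L} {i j : Fin d}
    (he : e ∉ ({(x, i), (x.shift i, j), (x.shift j, i), (x, j)} : Finset (Edge d L))) :
    plaquetteHolonomy (Function.update U e h) x i j = plaquetteHolonomy U x i j := by
  simp only [Finset.mem_insert, Finset.mem_singleton, not_or] at he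
  obtain ⟨h1, h2, h3, h4⟩ := he
  simp only [plaquetteHolonomy, Function.update_of_ne (Ne.symm h1),
    Function.update_of_ne (Ne.symm h2), Function.update_of_ne (Ne.symm h3),
    Function.update_of_ne (Ne.symm h4)]

end MatrixToolkit

section PlaquettePotential

variable {d L N : ℕ} {G : Type*} [Group G] [TopologicalSpace G] [IsTopologicalGroup G]
  [CompactSpace G] [MeasurableSpace G] [BorelSpace G] (ρ : G →* Matrix (Fin N) (Fin N) ℂ)

/-- **The plaquette potential and the one-link Lipschitz bound of its Hamiltonians.** The
potential of `Literature.MathematicalPhysics.QuantumLattice.exists_plaquettePotential`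
(`Φ_A = ∑_{p : edges(p) = A} (N − Re tr ρ(U_p))`, supported by the edge sets of plaquettes: adapted,
bounded terms, full-volume Hamiltonian `S_W`, interaction sets = plaquette edge sets), together
with: for a unitary `ρ`, every `H_Λ = ∑_{A : A ∩ Λ ≠ ∅} Φ_A` is Lipschitz in every single link,
`|H_Λ(U^{e ← h}) − H_Λ(U)| ≤ (d+1) · #{planes} · 4√N · ‖ρ h − ρ U_e‖_F`, uniformly in the torus, `Λ`
and `U` (only plaquettes through `e` move, each by `≤ 4 √N ‖ρ h − ρ U_e‖_F`, and a plaquette through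
`e = (y, k)` is based at `y` or at some `y − e_l`). -/
theorem exists_plaquettePotential_lipschitz [NeZero L] [SecondCountableTopology G]
    (hρ : Continuous ρ) (hρu : ∀ g, ρ g ∈ Matrix.unitaryGroup (Fin N) ℂ) :
    ∃ (Φ : Potential (Edge d L) G) (supp : Finset (Edge d L) → Finset (Finset (Edge d L))),
      Φ.IsAdapted ∧ (∀ A, ∃ C, ∀ U, |Φ A U| ≤ C) ∧ Φ.IsSupportedBy supp ∧
      (∀ U, hamiltonianIn Φ supp Finset.univ U = wilsonAction ρ U) ∧
      (∀ Λ, ∀ A ∈ supp Λ, ∃ (y : Site d L) (i j : Fin d), i < j ∧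
        A = {(y, i), (y.shift i, j), (y.shift j, i), (y, j)}) ∧
      (∀ (Λ : Finset (Edge d L)) (U : GaugeConfig d L G) (e : Edge d L) (h : G),
        |hamiltonianIn Φ supp Λ (Function.update U e h) - hamiltonianIn Φ supp Λ U| ≤
          (((d + 1) * Fintype.card {q : Fin d × Fin d // q.1 < q.2} : ℕ) : ℝ) *
            (4 * Real.sqrt N) * frobNorm (ρ h - ρ (U e))) := by
  -- adapted from `Literature.MathematicalPhysics.QuantumLattice.exists_plaquettePotential`
  -- (TorusWilsonGibbs): same potential, plus the last conjunct.
  set E : Plaquette d L → Finset (Edge d L) := fun p =>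
    {(p.1, p.2.1.1), (p.1.shift p.2.1.1, p.2.1.2), (p.1.shift p.2.1.2, p.2.1.1), (p.1, p.2.1.2)}
    with hE
  set c : Plaquette d L → GaugeConfig d L G → ℝ := fun p U =>
    (N : ℝ) - (ρ (plaquetteHolonomy U p.1 p.2.1.1 p.2.1.2)).trace.re with hc
  obtain ⟨M, -, hM⟩ := exists_bound_trace_re_nonneg ρ hρ
  refine ⟨fun A U => ∑ p : Plaquette d L with E p = A, c p U, fun _ => Finset.univ.image E,
    fun A => ⟨?_, ?_⟩, fun A => ?_, fun Λ A _ hne => ?_, fun U => ?_, fun Λ A hA => ?_,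
    fun Λ U e h => ?_⟩
  · -- `Φ_A` reads only the links in `A`
    intro U V h
    refine Finset.sum_congr rfl fun p hp => ?_
    have hpA : E p = A := (Finset.mem_filter.1 hp).2
    have h' : ∀ e ∈ E p, U e = V e := fun e he => h e (by rw [← hpA]; exact he)
    simp only [hc, plaquetteHolonomy]
    rw [h' _ (by simp [hE]), h' (p.1.shift p.2.1.1, p.2.1.2) (by simp [hE]),
      h' (p.1.shift p.2.1.2, p.2.1.1) (by simp [hE]), h' (p.1, p.2.1.2) (by simp [hE])]
  · -- measurability
    refine Finset.measurable_sum _ fun p _ => ?_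
    exact measurable_const.sub
      ((continuous_trace_re ρ hρ).measurable.comp (measurable_plaquetteHolonomy _ _ _))
  · -- bounded terms
    refine ⟨∑ p : Plaquette d L with E p = A, ((N : ℝ) + M), fun U => ?_⟩
    refine (Finset.abs_sum_le_sum_abs _ _).trans (Finset.sum_le_sum fun p _ => ?_)
    refine (abs_sub _ _).trans ?_
    rw [Nat.abs_cast]
    exact add_le_add le_rfl (hM _)
  · -- supported by the edge sets of plaquettes
    by_contra hA
    refine hne (funext fun U => Finset.sum_eq_zero fun p hp => ?_)
    exact absurd (Finset.mem_image.2 ⟨p, Finset.mem_univ _, (Finset.mem_filter.1 hp).2⟩) hA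
  · -- the full-volume Hamiltonian is the Wilson action
    unfold hamiltonianIn wilsonAction
    rw [Finset.filter_true_of_mem fun A hA => ?_]
    · exact Finset.sum_fiberwise_of_maps_to
        (fun p _ => Finset.mem_image_of_mem E (Finset.mem_univ p)) _
    · obtain ⟨p, -, rfl⟩ := Finset.mem_image.1 hA
      exact ⟨(p.1, p.2.1.1), by simp [hE]⟩
  · -- interaction sets are edge sets of plaquettes
    obtain ⟨p, -, rfl⟩ := Finset.mem_image.1 hA
    exact ⟨p.1, p.2.1.1, p.2.1.2, p.2.2, rfl⟩
  · -- one-link Lipschitz bound of `H_Λ`: each plaquette cost moves by `≤ 4 √N ‖Δρ‖_F`, only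
    -- plaquettes through `e` move, and these are based at `e.1` or some `e.1 - e_k`.
    set F : ℝ := frobNorm (ρ h - ρ (U e)) with hF
    have hcp : ∀ p : Plaquette d L, |c p (Function.update U e h) - c p U| ≤ Real.sqrt N * (4 * F) :=
      fun p => by
        simp only [hc]
        rw [abs_sub_comm, sub_sub_sub_cancel_left]
        exact abs_re_trace_holonomy_update_sub_le ρ hρu U e h p.1 p.2.1.1 p.2.1.2
    have hcard : (Finset.univ.filter fun p : Plaquette d L => e ∈ E p).card ≤
        (d + 1) * Fintype.card {q : Fin d × Fin d // q.1 < q.2} := by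
      have hsub : (Finset.univ.filter fun p : Plaquette d L => e ∈ E p) ⊆
          Finset.univ.image (fun oq : Option (Fin d) × {q : Fin d × Fin d // q.1 < q.2} =>
            ((oq.1.elim e.1 fun k => e.1 - Pi.single k 1 : Site d L), oq.2)) := by
        intro p hp
        have hp2 := (Finset.mem_filter.1 hp).2
        simp only [hE, Finset.mem_insert, Finset.mem_singleton] at hp2
        refine Finset.mem_image.2 ?_
        rcases hp2 with h1 | h1 | h1 | h1
        · exact ⟨(none, p.2), Finset.mem_univ _, by rw [h1]; simp⟩
        · exact ⟨(some p.2.1.1, p.2), Finset.mem_univ _, by rw [h1]; simp [Site.shift]⟩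
        · exact ⟨(some p.2.1.2, p.2), Finset.mem_univ _, by rw [h1]; simp [Site.shift]⟩
        · exact ⟨(none, p.2), Finset.mem_univ _, by rw [h1]; simp⟩
      refine (Finset.card_le_card hsub).trans (Finset.card_image_le.trans ?_)
      rw [Finset.card_univ, Fintype.card_prod, Fintype.card_option, Fintype.card_fin]
    have hsum : ∑ p : Plaquette d L, |c p (Function.update U e h) - c p U| ≤
        (((d + 1) * Fintype.card {q : Fin d × Fin d // q.1 < q.2} : ℕ) : ℝ) *
          (4 * Real.sqrt N) * F := by
      rw [← Finset.sum_filter_of_ne (p := fun p : Plaquette d L => e ∈ E p) fun p _ hp => ?_]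
      · calc ∑ p ∈ Finset.univ.filter (fun p : Plaquette d L => e ∈ E p),
              |c p (Function.update U e h) - c p U|
            ≤ ∑ _p ∈ Finset.univ.filter (fun p : Plaquette d L => e ∈ E p),
                Real.sqrt N * (4 * F) := Finset.sum_le_sum fun p _ => hcp p
          _ ≤ (((d + 1) * Fintype.card {q : Fin d × Fin d // q.1 < q.2} : ℕ) : ℝ) *
                (Real.sqrt N * (4 * F)) := by
              rw [Finset.sum_const, nsmul_eq_mul]
              exact mul_le_mul_of_nonneg_right (by exact_mod_cast hcard)
                (mul_nonneg (Real.sqrt_nonneg _) (mul_nonneg (by norm_num) (frobNorm_nonneg _)))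
          _ = _ := by ring
      · contrapose! hp
        simp only [hc]
        rw [plaquetteHolonomy_update_of_not_mem U h hp, sub_self, abs_zero]
    -- `|H_Λ(U') − H_Λ(U)| ≤ ∑_p |c_p(U') − c_p(U)|`
    refine le_trans ?_ hsum
    simp only [hamiltonianIn]
    rw [← Finset.sum_sub_distrib]
    refine (Finset.abs_sum_le_sum_abs _ _).trans ?_
    refine (Finset.sum_le_sum_of_subset_of_nonneg (Finset.filter_subset _ _)
      (fun _ _ _ => abs_nonneg _)).trans ?_
    refine (Finset.sum_le_sum (g := fun A => ∑ p : Plaquette d L with E p = A,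
      |c p (Function.update U e h) - c p U|) fun A _ => ?_).trans ?_
    · rw [← Finset.sum_sub_distrib]
      exact Finset.abs_sum_le_sum_abs _ _
    · rw [Finset.sum_fiberwise_of_maps_to
        (fun p _ => Finset.mem_image_of_mem E (Finset.mem_univ p))]

end PlaquettePotential

/-- `stub_lipschitzKernelVersion` — **one heat-bath step regularises** (P1; provable now, size L).
For the torus Wilson state at `β` (torus `(2S+1)⁴`), a finite link set `Λ` with a collar `T` (disjoint from
`Λ`, containing every edge of every plaquette meeting `Λ` that is not in `Λ`), and a bounded measurable `f`
reading only `Λ`: the DLR kernel `U ↦ ∫ f(V_Λ ⊕ U) e^{-β S_Λ(V_Λ ⊕ U)} dV / Z_Λ(U)` is a version of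
`E_μ[f | links off Λ]` which is measurable, bounded by the same `M`, reads only `T`, and is Lipschitz in
every link: changing `U_e` to `h` moves it by at most `c·M·‖r.ρ h − r.ρ(U_e)‖_F`, with `c = c(β, r)`
uniform in `S`, `Λ`, `T` (only plaquettes through `e` enter: `|ΔS_Λ| ≤ 30·4√N‖Δρ‖_F` here, and
`|E_{w'}f − E_w f| ≤ 2M(e^{2β sup|ΔS_Λ|} − 1)`).  Tree: `TorusWilsonGibbs` (DLR kernel of the plaquette
potential), `WilsonBlockHeatBath.exists_local_condExp_version` (locality, same hypotheses `hT`). -/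
theorem stub_lipschitzKernelVersion :
    ∀ (G : Type) [Group G] [TopologicalSpace G] [IsTopologicalGroup G] [CompactSpace G]
      [MeasurableSpace G] [BorelSpace G] (r : LatticeRep G) (β : ℝ),
    ∃ c : ℝ, ∀ (S : ℕ) (Λ T : Finset (Edge 4 (2 * S + 1))), Disjoint Λ T →
      (∀ (y : Site 4 (2 * S + 1)) (i j : Fin 4), i < j →
        (({(y, i), (y.shift i, j), (y.shift j, i), (y, j)} : Finset (Edge 4 (2 * S + 1))) ∩ Λ).Nonempty →
        (↑({(y, i), (y.shift i, j), (y.shift j, i), (y, j)} : Finset (Edge 4 (2 * S + 1))) :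
          Set (Edge 4 (2 * S + 1))) ⊆ ↑Λ ∪ ↑T) →
      ∀ (f : GaugeConfig 4 (2 * S + 1) G → ℝ) (M : ℝ), Measurable f → (∀ U, |f U| ≤ M) →
        DependsOn f (↑Λ : Set (Edge 4 (2 * S + 1))) →
      ∃ f' : GaugeConfig 4 (2 * S + 1) G → ℝ, Measurable f' ∧ (∀ U, |f' U| ≤ M) ∧
        DependsOn f' (↑T : Set (Edge 4 (2 * S + 1))) ∧
        (∀ (U : GaugeConfig 4 (2 * S + 1) G) (e : Edge 4 (2 * S + 1)) (h : G),
          |f' (Function.update U e h) - f' U| ≤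
            c * M * Real.sqrt (∑ a, ∑ b, ‖(r.ρ h - r.ρ (U e)) a b‖ ^ 2)) ∧
        f' =ᵐ[(wilsonMeasure r.ρ β : Measure (GaugeConfig 4 (2 * S + 1) G))]
          (wilsonMeasure r.ρ β : Measure (GaugeConfig 4 (2 * S + 1) G))[f | cylinderEvents ((↑Λ : Set (Edge 4 (2 * S + 1)))ᶜ)] := by
  intro G _ _ _ _ _ _ r β
  haveI : SecondCountableTopology G :=
    (r.continuous.isClosedEmbedding r.injective).isEmbedding.secondCountableTopology
  haveI : T2Space G := (r.continuous.isClosedEmbedding r.injective).isEmbedding.t2Space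
  -- the one-link Lipschitz constant `a` of `H_Λ` and the `‖·‖_F`-diameter `D` of `ρ(G)`
  set a : ℝ := (((4 + 1) * Fintype.card {q : Fin 4 × Fin 4 // q.1 < q.2} : ℕ) : ℝ) *
    (4 * Real.sqrt r.N) with ha
  have ha0 : 0 ≤ a := by positivity
  set D : ℝ := 2 * Real.sqrt r.N with hD
  refine ⟨4 * |β| * a * Real.exp (2 * (|β| * (a * D))), ?_⟩
  intro S Λ T _ hT f M hfm hfM hfΛ
  obtain ⟨Φ, supp, hΦ, hΦb, hsupp, hH, hplaq, hLip⟩ :=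
    exists_plaquettePotential_lipschitz (d := 4) (L := 2 * S + 1) r.ρ r.continuous r.mem_unitary
  have hμ := isGibbsMeasure_wilsonMeasure r.ρ r.continuous hΦ hΦb hsupp hH β
  have hγ := isSpecification_gibbsSpecOfPotential (haarProbability G) hΦ hΦb hsupp β
  set γ := gibbsSpecOfPotential (haarProbability G) Φ supp β with hγdef
  have hT' : ∀ A ∈ supp Λ, (A ∩ Λ).Nonempty → (↑A : Set (Edge 4 (2 * S + 1))) ⊆ ↑Λ ∪ ↑T := by
    intro A hA hne
    obtain ⟨y, i, j, hij, rfl⟩ := hplaq Λ A hA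
    exact hT y i j hij hne
  have hfΛT : DependsOn f ((↑Λ : Set (Edge 4 (2 * S + 1))) ∪ ↑T) := hfΛ.mono Set.subset_union_left
  obtain ⟨hsm, hae⟩ := stronglyMeasurable_and_ae_eq_condExp_integral_gibbsSpecOfPotential
    (haarProbability G) hΦ hΦb hsupp β hμ Λ hT' hfm hfM hfΛT
  have hbd : ∀ η, |∫ σ, f σ ∂(γ Λ η)| ≤ M := fun η => by
    haveI := hγ.isProbability Λ η
    have := norm_integral_le_of_norm_le_const (μ := γ Λ η) (f := f) (C := M)
      (ae_of_all _ fun U => by rw [Real.norm_eq_abs]; exact hfM U)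
    simpa [Real.norm_eq_abs] using this
  refine ⟨fun η => ∫ σ, f σ ∂(γ Λ η), hsm.measurable.mono cylinderEvents_le_pi le_rfl, hbd,
    dependsOn_integral_gibbsSpecOfPotential (haarProbability G) hΦ supp β Λ hT'
      hfm.stronglyMeasurable hfΛT, fun U e h => ?_, hae⟩
  -- ONE HEAT-BATH STEP REGULARISES: `|γ_Λ f(U^{e ← h}) − γ_Λ f(U)| ≤ c M ‖ρ h − ρ U_e‖_F`
  show |(∫ σ, f σ ∂(γ Λ (Function.update U e h))) - ∫ σ, f σ ∂(γ Λ U)| ≤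
    _ * frobNorm (r.ρ h - r.ρ (U e))
  set F : ℝ := frobNorm (r.ρ h - r.ρ (U e)) with hF
  have hF0 : 0 ≤ F := frobNorm_nonneg _
  have hFD : F ≤ D := (frobNorm_sub_le_of_mem_unitaryGroup (r.mem_unitary h)
    (r.mem_unitary (U e))).trans_eq (by rw [Fintype.card_fin])
  have hM0 : 0 ≤ M := (abs_nonneg _).trans (hfM U)
  rcases hM0.eq_or_lt with hM | hMpos
  · -- `M = 0`: both kernel averages vanish
    obtain ⟨hA, hB⟩ := And.intro (hbd (Function.update U e h)) (hbd U)
    rw [← hM, abs_nonpos_iff] at hA hB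
    simp [hA, hB, ← hM]
  -- `M > 0`: compare the two kernels on the `[0,1]`-valued observable `g = (f + M) / 2M`
  set g : GaugeConfig 4 (2 * S + 1) G → ℝ := fun σ => (f σ + M) / (2 * M) with hg
  have hgm : Measurable g := (hfm.add_const M).div_const _
  have hg01 : ∀ σ, 0 ≤ g σ ∧ g σ ≤ 1 := fun σ => by
    have := abs_le.1 (hfM σ)
    exact ⟨div_nonneg (by linarith) (by linarith), div_le_one_of_le₀ (by linarith) (by linarith)⟩
  have hgI : ∀ η, ∫ σ, g σ ∂(γ Λ η) = (∫ σ, f σ ∂(γ Λ η) + M) / (2 * M) := fun η => by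
    haveI := hγ.isProbability Λ η
    have hfi : Integrable f (γ Λ η) := Integrable.of_bound hfm.aestronglyMeasurable M
      (ae_of_all _ fun σ => by rw [Real.norm_eq_abs]; exact hfM σ)
    simp only [hg]; rw [integral_div, integral_add hfi (integrable_const M)]; simp
  have hgζ : ∀ u : ↥Λ → G, g (glueWith Λ u (Function.update U e h)) = g (glueWith Λ u U) := by
    intro u
    have hfeq : f (glueWith Λ u (Function.update U e h)) = f (glueWith Λ u U) :=
      hfΛ fun i hi => by simp only [glueWith_apply_mem _ _ _ (Finset.mem_coe.1 hi)]
    simp only [hg, hfeq]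
  -- the tilt `-β H_Λ`: measurable, bounded, Lipschitz in the exterior link `e` (constant `|β| a`)
  have hφm : Measurable fun σ : GaugeConfig 4 (2 * S + 1) G => -β * hamiltonianIn Φ supp Λ σ :=
    (measurable_hamiltonianIn (fun A => (hΦ A).2) supp Λ).const_mul _
  have hφb : ∃ C, ∀ σ : GaugeConfig 4 (2 * S + 1) G, |-β * hamiltonianIn Φ supp Λ σ| ≤ C := by
    choose C hC using hΦb
    refine ⟨|β| * ∑ A ∈ supp Λ with (A ∩ Λ).Nonempty, C A, fun σ => ?_⟩
    rw [abs_mul, abs_neg]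
    exact mul_le_mul_of_nonneg_left (abs_hamiltonianIn_le hC supp Λ σ) (abs_nonneg β)
  have hLipa : ∀ (V : GaugeConfig 4 (2 * S + 1) G) (h' : G),
      |hamiltonianIn Φ supp Λ (Function.update V e h') - hamiltonianIn Φ supp Λ V| ≤
        a * frobNorm (r.ρ h' - r.ρ (V e)) := fun V h' => hLip Λ V e h'
  set ε : ℝ := |β| * (a * F) with hε
  have hε0 : 0 ≤ ε := by positivity
  have hglue : ∀ u : ↥Λ → G,
      |-β * hamiltonianIn Φ supp Λ (glueWith Λ u (Function.update U e h)) -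
        -β * hamiltonianIn Φ supp Λ (glueWith Λ u U)| ≤ ε := fun u => by
    -- the two glued configurations differ at most in the link `e`
    have hgl : glueWith Λ u (Function.update U e h) =
        Function.update (glueWith Λ u U) e (glueWith Λ u (Function.update U e h) e) := by
      funext x
      by_cases hxe : x = e
      · rw [hxe, Function.update_self]
      · rw [Function.update_of_ne hxe]
        by_cases hx : x ∈ Λ
        · rw [glueWith_apply_mem _ _ _ hx, glueWith_apply_mem _ _ _ hx]
        · rw [glueWith_apply_not_mem _ _ _ hx, glueWith_apply_not_mem _ _ _ hx,
            Function.update_of_ne hxe]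
    have hVe :
        frobNorm (r.ρ (glueWith Λ u (Function.update U e h) e) - r.ρ (glueWith Λ u U e)) ≤ F := by
      by_cases he : e ∈ Λ
      · rw [glueWith_apply_mem _ _ _ he, glueWith_apply_mem _ _ _ he, sub_self, frobNorm_zero]
        exact hF0
      · rw [glueWith_apply_not_mem _ _ _ he, glueWith_apply_not_mem _ _ _ he, Function.update_self]
    rw [hgl, ← mul_sub, abs_mul, abs_neg]
    exact mul_le_mul_of_nonneg_left ((hLipa _ _).trans (mul_le_mul_of_nonneg_left hVe ha0))
      (abs_nonneg β)
  have h1 : ∫ σ, g σ ∂(γ Λ (Function.update U e h)) ≤ Real.exp (2 * ε) * ∫ σ, g σ ∂(γ Λ U) :=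
    integral_glued_tilted_le_exp_mul (haarProbability G) Λ (Function.update U e h) U
      hφm hφm hφb hφb hgm hg01 hgζ (c := 0) (fun u => by rw [sub_zero]; exact hglue u)
  have h2 :
      ∫ σ, g σ ∂(γ Λ U) ≤ Real.exp (2 * ε) * ∫ σ, g σ ∂(γ Λ (Function.update U e h)) :=
    integral_glued_tilted_le_exp_mul (haarProbability G) Λ U (Function.update U e h)
      hφm hφm hφb hφb hgm hg01 (fun u => (hgζ u).symm) (c := 0)
      (fun u => by rw [sub_zero, abs_sub_comm]; exact hglue u)
  rw [hgI (Function.update U e h), hgI U] at h1 h2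
  obtain ⟨hA, hB⟩ := And.intro (hbd (Function.update U e h)) (hbd U)
  have hE1 : 1 ≤ Real.exp (2 * ε) := Real.one_le_exp (by positivity)
  -- from the two ratio bounds on `[0,1]`-valued averages to a bound on the difference
  have key : ∀ {A B : ℝ}, |B| ≤ M → (A + M) / (2 * M) ≤ Real.exp (2 * ε) * ((B + M) / (2 * M)) →
      A - B ≤ 2 * M * (Real.exp (2 * ε) - 1) := by
    intro A B hB h
    rw [div_le_iff₀ (mul_pos two_pos hMpos), mul_assoc,
      div_mul_cancel₀ _ (mul_pos two_pos hMpos).ne'] at h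
    nlinarith [(abs_le.1 hB).2, sub_nonneg.2 hE1]
  have hAB : |(∫ σ, f σ ∂(γ Λ (Function.update U e h))) - ∫ σ, f σ ∂(γ Λ U)| ≤
      2 * M * (Real.exp (2 * ε) - 1) :=
    abs_sub_le_iff.2 ⟨key hB h1, key hA h2⟩
  have hexp1 : Real.exp (2 * ε) - 1 ≤ 2 * ε * Real.exp (2 * ε) := by
    have h := Real.add_one_le_exp (-(2 * ε))
    have hmul : Real.exp (-(2 * ε)) * Real.exp (2 * ε) = 1 := by
      rw [← Real.exp_add, neg_add_cancel, Real.exp_zero]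
    nlinarith [mul_le_mul_of_nonneg_right h (Real.exp_pos (2 * ε)).le]
  have hexp2 : Real.exp (2 * ε) ≤ Real.exp (2 * (|β| * (a * D))) :=
    Real.exp_le_exp.2 (mul_le_mul_of_nonneg_left
      (mul_le_mul_of_nonneg_left (mul_le_mul_of_nonneg_left hFD ha0) (abs_nonneg β)) zero_le_two)
  calc |(∫ σ, f σ ∂(γ Λ (Function.update U e h))) - ∫ σ, f σ ∂(γ Λ U)|
      ≤ 2 * M * (Real.exp (2 * ε) - 1) := hAB
    _ ≤ 2 * M * (2 * ε * Real.exp (2 * ε)) :=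
        mul_le_mul_of_nonneg_left hexp1 (mul_nonneg zero_le_two hM0)
    _ ≤ 2 * M * (2 * ε * Real.exp (2 * (|β| * (a * D)))) :=
        mul_le_mul_of_nonneg_left (mul_le_mul_of_nonneg_left hexp2 (mul_nonneg zero_le_two hε0))
          (mul_nonneg zero_le_two hM0)
    _ = 4 * |β| * a * Real.exp (2 * (|β| * (a * D))) * M * F := by rw [hε]; ring

end Summit.QuantumFields.YangMills.Theorems.LatticeGapLargeBeta.WittenIMS

end
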